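import Summits.QuantumFields.YangMills.Theorems.UnitScaleTiltProp7SPrintDefsS
import Summits.QuantumFields.YangMills.Theorems.UnitScaleTiltProp7SectET3CurvedPropagatorsT3
import HarnessLib

/-!
# Route `UnitScaleTilt`, crux K1 «MinimiserStabilityRegPr» (stmt-QuantumFields-19200) — route-R E′ growth side, NAMER WORD 5 (p1 g17) IN KERNEL FORM:
# ON PRINT'S SLICE `R(U₀)D*_{U₀}A = 0` THE GAUGE PENALTY OF `Δ_a = Δ + DRD* + Q*aQ` VANISHES, SO THE ACTION HESSIAN INHERITS `Δ_a`'S COERCIVITY UP TO THE AVERAGING PENALTY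
# ([Balaban1985Variational] p.299 (141)–(142): «A second order differential at A′ = 0 is given by the quadratic form above, and it is positive definite»)

Cell `ym3-torus` ∕ fleet seat `ym-ust-19200-p1` (gen 17, route-R E′ lead ∕ namer).  THEOREMS ONLY (0 `def`, 0 `sorry`); `--supports stmt-QuantumFields-19200`, count-neutral.
YM₃ on T³ is a ladder rung (R3), not the Clay problem; nothing here claims the stub, the crux, HESS, `hcoW`, d = 4 or the mass gap.

WHY (memo `LOCATE-EPRIME-SLICE-p1g17.md`, 19200 evidence #49).  By kernel the growth side's analytic residue is the K-only Hessian row HESS ≡ κ-ROW′ (✓`Prop7LocMinOfChartSliceHess`,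
✓`Prop7HKgKOfRRow`), and the S3∕ζ-row funnel consumes it (hKg-K ⟸ κ-ROW′), so it cannot supply it.  Print supplies it differently: the quadratic form of the expanded action on the
LINEAR space `{QA′ = 0, R D*A′ = 0}` equals `⟨A′, (Δ₁ + DRD* + Q*aQ)A′⟩` — both penalties vanish there — and `Δ₁ + DRD* + Q*aQ = G₁⁻¹` is positive ([Balaban1985BackgroundPropagators]
Thm 3.11; [Balaban1985Variational] (110)–(111), p.293's scalar product).  This file is that sentence, kernel-checked: §1 over lit-balaban's abstract `laplaceAK` (any `𝕜`-inner-product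
spaces); §2 read at the EX lane's member letters (`laplaceA … Δx U₀ = Δx(U₀) + D_{U₀}R_S(U₀)D*_{U₀} + Q_k*aQ_k`, ✓`Prop7SectET3CurvedPropagators`; the projected Landau member
`IsLandauPrintS U₀ X ⟺ R_S(U₀)(D*_{U₀}X̃) = 0`, ✓`Prop7SPrintDefsS`): a coercivity row for `Δ_a(U₀)` (the QUANTITATIVE form of the EX display's `hPosΔ`∕`hPos₁`) yields, for every
route field `X` in the projected Landau gauge, `γ·‖X̃‖² − a·‖Q_kX̃‖² ≤ re⟨X̃, Δx(U₀)X̃⟩`, and `γ·‖X̃‖² ≤ re⟨X̃, Δx(U₀)X̃⟩` on `ker Q_k` — HESS in print's currency, with NO divergence term.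

WHAT IS PROVED (ns `…Theorems.Prop7HessOnPrintSlice`).
§1 ★ `laplaceAK_apply_of_landau`, `laplaceAK_apply_of_slice`, `inner_laplaceAK_of_slice`, ★ `re_inner_laplaceAK_of_landau` (`re⟨x, Δ_a x⟩ = re⟨x, Δx⟩ + re a·‖Qx‖²` when `R(D*x) = 0`,
`Q* = Q†`), ★★ `coercive_on_landau_of_coercive`, ★★ `coercive_on_slice_of_coercive`.
§2 ★ `laplaceA_eq_laplaceAK` (the member's `Δ_a` IS `laplaceAK` at `D := DL2`, `D* := DstarL2`, `R := R_S`, `Q := Q_k`, `Q* := Q_k†`, by `rfl`), ★★ `re_inner_laplaceA_of_isLandauPrintS`,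
★★★ `hess_of_laplaceA_coercive_of_isLandauPrintS` (gauge slice), ★★★ `hess_of_laplaceA_coercive_of_isLandauPrintS_of_ker` (gauge slice ∩ `ker Q_k`).
HONEST SCOPE.  Linear algebra over landed letters; the coercivity of `Δ_a(U₀)` is a HYPOTHESIS (N06-class: Thm 3.11 + the `L²` bound of Thm 3.3∕3.12; flat theorem
✓`Prop7FlatCoercivityR.flat_coercive_R_T3`); nothing of HESS at `IsCritR2`, `hcoW`, E′, EX or the crux is claimed.

References: T. Bałaban, CMP 102 (1985) 277–309 [Balaban1985Variational] ((19)–(21) p.281, (79) p.290, p.293, (106)–(111) p.294, (141)–(142) p.299, Prop. 7 p.299);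
CMP 99 (1985) 389–434 [Balaban1985BackgroundPropagators] ((3.21)–(3.26) pp.394–395, Thm 3.11 p.416, (3.118)–(3.122) pp.419–420); CMP 99 (1985) 75–102 [Balaban1985RegularSpaces]
(p.80, (1.38) p.82).
-/

set_option autoImplicit false

noncomputable section

open scoped InnerProductSpace ComplexConjugate BigOperators

namespace Summit.QuantumFields.YangMills.Theorems.Prop7HessOnPrintSlice

open Literature.MathematicalPhysics.QuantumFieldTheory.Balaban1983to89
open Literature.MathematicalPhysics.QuantumFieldTheory.Balaban1983to89.T3ContinuumYM3Torus
open B11Eq103H1Complex (SiteL2K BondL2K laplaceAK laplaceAK_apply laplaceALatticeK)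
open B9Eq311L2Pairing (WL2)
open Summit.QuantumFields.YangMills.Theorems.Prop7SectET3Transport (periodsT3)
open Summit.QuantumFields.YangMills.Theorems.Prop7SectET3HilbertLetters (W₂ adBg adBgInv toL2 DL2 DstarL2)
open Summit.QuantumFields.YangMills.Theorems.Prop7SectET3GaugeProjector (RS)
open Summit.QuantumFields.YangMills.Theorems.Prop7SectET3CurvedPropagators (Qk laplaceA)
open Summit.QuantumFields.YangMills.Theorems.Prop7SPrint (IsLandauPrintS isLandauPrintS_iff_RS)

/-! ## §1 The abstract sentence: on `{R(D*x) = 0}` the gauge penalty of `Δ_a = Δ + DRD* + Q*aQ` vanishes -/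

section Abstract

variable {𝕜 : Type*} [RCLike 𝕜] {E : Type*} [NormedAddCommGroup E] [InnerProductSpace 𝕜 E]
  {F : Type*} [NormedAddCommGroup F] [InnerProductSpace 𝕜 F] {S : Type*} [AddCommGroup S] [Module 𝕜 S]
  (Δ : E →ₗ[𝕜] E) (D : S →ₗ[𝕜] E) (R : S →ₗ[𝕜] S) (Dstar : E →ₗ[𝕜] S) (Q : E →ₗ[𝕜] F) (Qadj : F →ₗ[𝕜] E) (a : 𝕜)

/-- ★ **On the gauge slice `R(D*x) = 0`: `Δ_a x = Δx + Q*(a·Qx)`** — the `DRD*` penalty vanishes ([Balaban1985Variational] (76)∕(79): «we have used again the fact that A′ satisfy the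
Landau gauge condition RD*A′ = 0»). [cite: Balaban1985Variational, (76) p.289, (79) p.290; Balaban1985BackgroundPropagators, (3.26) p.395] -/
theorem laplaceAK_apply_of_landau {x : E} (hR : R (Dstar x) = 0) :
    laplaceAK Δ D R Dstar Q Qadj a x = Δ x + Qadj (a • Q x) := by
  rw [laplaceAK_apply, hR, map_zero, add_zero]

/-- ★ **On print's slice `R(D*x) = 0`, `Qx = 0`: `Δ_a x = Δx`** — both penalties vanish ((141): variations `δA′` with `QδA′ = 0`, `RD*δA′ = 0`).
[cite: Balaban1985Variational, (141)–(142) p.299] -/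
theorem laplaceAK_apply_of_slice {x : E} (hR : R (Dstar x) = 0) (hQ : Q x = 0) :
    laplaceAK Δ D R Dstar Q Qadj a x = Δ x := by
  rw [laplaceAK_apply_of_landau Δ D R Dstar Q Qadj a hR, hQ, smul_zero, map_zero, add_zero]

/-- `⟨x, Δ_a x⟩ = ⟨x, Δx⟩` on print's slice. [cite: Balaban1985Variational, (142) p.299] -/
theorem inner_laplaceAK_of_slice {x : E} (hR : R (Dstar x) = 0) (hQ : Q x = 0) :
    ⟪x, laplaceAK Δ D R Dstar Q Qadj a x⟫_𝕜 = ⟪x, Δ x⟫_𝕜 := by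
  rw [laplaceAK_apply_of_slice Δ D R Dstar Q Qadj a hR hQ]

/-- ★ **`re⟨x, Δ_a x⟩ = re⟨x, Δx⟩ + re a·‖Qx‖²` on the gauge slice**, when `Q*` is the Hilbert adjoint of `Q` (print: «the adjoints are taken with respect to natural L² scalar
products»). [cite: Balaban1985BackgroundPropagators, (3.26) p.395, p.391; Balaban1985Variational, (79) p.290] -/
theorem re_inner_laplaceAK_of_landau [FiniteDimensional 𝕜 E] [FiniteDimensional 𝕜 F] (hadj : Qadj = LinearMap.adjoint Q) {x : E} (hR : R (Dstar x) = 0) :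
    RCLike.re ⟪x, laplaceAK Δ D R Dstar Q Qadj a x⟫_𝕜 = RCLike.re ⟪x, Δ x⟫_𝕜 + RCLike.re a * ‖Q x‖ ^ 2 := by
  rw [laplaceAK_apply_of_landau Δ D R Dstar Q Qadj a hR, inner_add_right, map_add, hadj, LinearMap.adjoint_inner_right, inner_smul_right,
    inner_self_eq_norm_sq_to_K]
  congr 1
  rw [show (a * ((‖Q x‖ : 𝕜) ^ 2) : 𝕜) = a * (((‖Q x‖ ^ 2 : ℝ)) : 𝕜) by push_cast; ring, RCLike.re_mul_ofReal]

/-- ★★ **COERCIVITY OF `Δ_a` ⟹ COERCIVITY OF `Δ` UP TO THE AVERAGING PENALTY, ON THE GAUGE SLICE**: if `γ‖y‖² ≤ re⟨y, Δ_a y⟩` for all `y`, then for `R(D*x) = 0`: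
`γ‖x‖² − re a·‖Qx‖² ≤ re⟨x, Δx⟩` (print's (142) with the constraint linearised: the competitor's `A′` has `QA′ = 0` exactly, (75) with `B = 0`). [cite: Balaban1985Variational, (141)–(142) p.299, (106) p.294] -/
theorem coercive_on_landau_of_coercive [FiniteDimensional 𝕜 E] [FiniteDimensional 𝕜 F] (hadj : Qadj = LinearMap.adjoint Q) {γ : ℝ}
    (hco : ∀ y : E, γ * ‖y‖ ^ 2 ≤ RCLike.re ⟪y, laplaceAK Δ D R Dstar Q Qadj a y⟫_𝕜) {x : E} (hR : R (Dstar x) = 0) :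
    γ * ‖x‖ ^ 2 - RCLike.re a * ‖Q x‖ ^ 2 ≤ RCLike.re ⟪x, Δ x⟫_𝕜 := by
  have h := hco x
  rw [re_inner_laplaceAK_of_landau Δ D R Dstar Q Qadj a hadj hR] at h
  linarith

/-- ★★ **THE K-ONLY HESSIAN ON PRINT'S SLICE**: if `γ‖y‖² ≤ re⟨y, Δ_a y⟩` for all `y`, then `γ‖x‖² ≤ re⟨x, Δx⟩` for every `x` with `R(D*x) = 0`, `Qx = 0` — [Balaban1985Variational]
p.299: «A second order differential at A′ = 0 is given by the quadratic form above, and it is positive definite». [cite: Balaban1985Variational, (141)–(142) p.299; Balaban1985BackgroundPropagators, Thm 3.11 p.416] -/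
theorem coercive_on_slice_of_coercive {γ : ℝ} (hco : ∀ y : E, γ * ‖y‖ ^ 2 ≤ RCLike.re ⟪y, laplaceAK Δ D R Dstar Q Qadj a y⟫_𝕜)
    {x : E} (hR : R (Dstar x) = 0) (hQ : Q x = 0) :
    γ * ‖x‖ ^ 2 ≤ RCLike.re ⟪x, Δ x⟫_𝕜 := by
  have h := hco x
  rwa [inner_laplaceAK_of_slice Δ D R Dstar Q Qadj a hR hQ] at h

end Abstract

/-! ## §2 The same at the EX lane's member letters (`laplaceA`, `R_S`, `Q_k`, `IsLandauPrintS`) -/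

section Member

variable (F : T3Family) (n K : ℕ) (h : n ≤ K) (c₀ cB a : ℝ) [Fact (0 < c₀)] [Fact (0 < cB)]
  (Δx : GaugeField (F.P K) 0 (Matrix.specialUnitaryGroup (Fin 2) ℂ) → (BondL2K ℂ 3 (periodsT3 F K) c₀ W₂ →ₗ[ℂ] BondL2K ℂ 3 (periodsT3 F K) c₀ W₂))

/-- ★ **THE MEMBER'S `Δ_a(U₀)` IS lit-balaban's `laplaceAK`** at `Δ := Δx(U₀)`, `D := D_{U₀}` (`DL2`), `R := R_S(U₀)`, `D* := D*_{U₀}` (`DstarL2`), `Q := Q_k(U₀)`, `Q* := Q_k†`, weight `a`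
— by `rfl` through ✓`laplaceA` ∕ ✓`laplaceALatticeK`. [cite: Balaban1985BackgroundPropagators, (3.26) p.395; Balaban1985Variational, (110) p.294] -/
theorem laplaceA_eq_laplaceAK (U₀ : GaugeField (F.P K) 0 (Matrix.specialUnitaryGroup (Fin 2) ℂ)) :
    laplaceA F n K h c₀ cB a Δx U₀
      = laplaceAK (Δx U₀) (DL2 F n K c₀ U₀) (RS F n K h c₀ cB U₀) (DstarL2 F n K c₀ U₀) (Qk F n K h c₀ cB U₀)
          (LinearMap.adjoint (Qk F n K h c₀ cB U₀)) ((a : ℝ) : ℂ) := rfl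

/-- ★★ **ON THE PROJECTED LANDAU GAUGE `IsLandauPrintS U₀ X`: `re⟨X̃, Δ_a(U₀)X̃⟩ = re⟨X̃, Δx(U₀)X̃⟩ + a·‖Q_k(U₀)X̃‖²`**, `X̃ = toL2 X` — the `D R_S D*` penalty vanishes on the route's
Landau member (21)ˢ. [cite: Balaban1985Variational, (21) p.281, (79) p.290; Balaban1985BackgroundPropagators, (3.26) p.395] -/
theorem re_inner_laplaceA_of_isLandauPrintS (U₀ : GaugeField (F.P K) 0 (Matrix.specialUnitaryGroup (Fin 2) ℂ)) (X : PBond (F.P K) 0 → Matrix (Fin 2) (Fin 2) ℂ)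
    (hX : IsLandauPrintS F n K h c₀ cB U₀ X) :
    RCLike.re ⟪toL2 F K c₀ X, laplaceA F n K h c₀ cB a Δx U₀ (toL2 F K c₀ X)⟫_ℂ
      = RCLike.re ⟪toL2 F K c₀ X, Δx U₀ (toL2 F K c₀ X)⟫_ℂ + a * ‖Qk F n K h c₀ cB U₀ (toL2 F K c₀ X)‖ ^ 2 := by
  have hR := (isLandauPrintS_iff_RS (h := h) (cB := cB) U₀ X).1 hX
  rw [laplaceA_eq_laplaceAK, re_inner_laplaceAK_of_landau _ _ _ _ _ _ _ rfl hR]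
  have ha : RCLike.re ((a : ℝ) : ℂ) = a := by simp [RCLike.re_to_complex]
  rw [ha]

/-- ★★★ **HESS IN PRINT'S CURRENCY ON THE GAUGE SLICE**: a coercivity row `γ‖y‖² ≤ re⟨y, Δ_a(U₀)y⟩` (the quantitative form of the EX display's positivity rows; [B9] Thm 3.11 with the
`L²` bound of Thm 3.3∕3.12) gives, for every route field `X` in the projected Landau gauge (21)ˢ, `γ‖X̃‖² − a‖Q_k(U₀)X̃‖² ≤ re⟨X̃, Δx(U₀)X̃⟩` — the action Hessian is coercive up to the
averaging penalty, with NO divergence term. [cite: Balaban1985Variational, (141)–(142) p.299, (106) p.294; Balaban1985BackgroundPropagators, Thm 3.11 p.416] -/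
theorem hess_of_laplaceA_coercive_of_isLandauPrintS (U₀ : GaugeField (F.P K) 0 (Matrix.specialUnitaryGroup (Fin 2) ℂ)) {γ : ℝ}
    (hco : ∀ y : BondL2K ℂ 3 (periodsT3 F K) c₀ W₂, γ * ‖y‖ ^ 2 ≤ RCLike.re ⟪y, laplaceA F n K h c₀ cB a Δx U₀ y⟫_ℂ)
    (X : PBond (F.P K) 0 → Matrix (Fin 2) (Fin 2) ℂ) (hX : IsLandauPrintS F n K h c₀ cB U₀ X) :
    γ * ‖toL2 F K c₀ X‖ ^ 2 - a * ‖Qk F n K h c₀ cB U₀ (toL2 F K c₀ X)‖ ^ 2 ≤ RCLike.re ⟪toL2 F K c₀ X, Δx U₀ (toL2 F K c₀ X)⟫_ℂ := by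
  have h1 := hco (toL2 F K c₀ X)
  rw [re_inner_laplaceA_of_isLandauPrintS F n K h c₀ cB a Δx U₀ X hX] at h1
  linarith

/-- ★★★ **THE K-ONLY HESSIAN ON PRINT'S SLICE ∩ `ker Q_k`** ([Balaban1985Variational] p.299, (141)–(142), for the variations∕competitors with `QA′ = 0`, `RD*A′ = 0`): a coercivity row for
`Δ_a(U₀)` gives `γ‖X̃‖² ≤ re⟨X̃, Δx(U₀)X̃⟩` for every `X` with `IsLandauPrintS U₀ X` and `Q_k(U₀)X̃ = 0`. [cite: Balaban1985Variational, (141)–(142) p.299, Prop. 7 p.299; Balaban1985BackgroundPropagators, Thm 3.11 p.416] -/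
theorem hess_of_laplaceA_coercive_of_isLandauPrintS_of_ker (U₀ : GaugeField (F.P K) 0 (Matrix.specialUnitaryGroup (Fin 2) ℂ)) {γ : ℝ}
    (hco : ∀ y : BondL2K ℂ 3 (periodsT3 F K) c₀ W₂, γ * ‖y‖ ^ 2 ≤ RCLike.re ⟪y, laplaceA F n K h c₀ cB a Δx U₀ y⟫_ℂ)
    (X : PBond (F.P K) 0 → Matrix (Fin 2) (Fin 2) ℂ) (hX : IsLandauPrintS F n K h c₀ cB U₀ X) (hQ : Qk F n K h c₀ cB U₀ (toL2 F K c₀ X) = 0) :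
    γ * ‖toL2 F K c₀ X‖ ^ 2 ≤ RCLike.re ⟪toL2 F K c₀ X, Δx U₀ (toL2 F K c₀ X)⟫_ℂ := by
  have h1 := hess_of_laplaceA_coercive_of_isLandauPrintS F n K h c₀ cB a Δx U₀ hco X hX
  rw [hQ, norm_zero] at h1
  simpa using h1

end Member


/-! ## §3 (append p1 g17, PLAN (A′) P-A4) THE CRUDE SLICE ON PRINT'S SLICE FROM A BERNSTEIN ROW ON `ker R_S`
On print's slice the divergence `D*x` lies in `ker R = (Δ N(Q′))^⊥`, the range of `G(Q∘D)ᵀ` — smooth at scale ℓ ([Balaban1985BackgroundPropagators] (3.21)∕(3.126)); a Bernstein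
inequality `‖Df‖² ≤ C·‖f‖²` on that space (flat: the alias-sum Bernstein ✓`Prop7AliasSumBernstein`∕✓p681767 class, `C = C_B·ℓ⁻²`) turns into the divergence bound
`‖D*x‖² ≤ C·‖x‖²` by ONE Cauchy–Schwarz — the doors' «crude slice» `DIV ≤ δ₁ℓ⁻²M` with `ζ = 0`, `δ₁` L-only, NO alignment row, NO local model. -/

section CrudeAbstract

variable {𝕜 : Type*} [RCLike 𝕜] {E : Type*} [NormedAddCommGroup E] [InnerProductSpace 𝕜 E]
  {S : Type*} [NormedAddCommGroup S] [InnerProductSpace 𝕜 S]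

/-- ★★ **ONE CAUCHY–SCHWARZ: a Bernstein bound at the single vector `f := D*x` gives the divergence bound.**  If `⟨D*x, f⟩ = ⟨x, Df⟩` (adjoint pair) and
`‖D(D*x)‖² ≤ C·‖D*x‖²` with `0 ≤ C`, then `‖D*x‖² ≤ C·‖x‖²`.  (`‖D*x‖² = re⟨x, DD*x⟩ ≤ ‖x‖·√C·‖D*x‖`.) [folklore] [cite: Balaban1985BackgroundPropagators, (3.8) p.392, (3.21) p.394] -/
theorem norm_sq_dstar_le_of_bernstein_at (D : S →ₗ[𝕜] E) (Dstar : E →ₗ[𝕜] S)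
    (hadj : ∀ (x : E) (f : S), ⟪Dstar x, f⟫_𝕜 = ⟪x, D f⟫_𝕜) {C : ℝ} (hC : 0 ≤ C) (x : E)
    (hB : ‖D (Dstar x)‖ ^ 2 ≤ C * ‖Dstar x‖ ^ 2) :
    ‖Dstar x‖ ^ 2 ≤ C * ‖x‖ ^ 2 := by
  -- `‖D*x‖² = re⟨D*x, D*x⟩ = re⟨x, D D*x⟩ ≤ ‖x‖·‖D D*x‖`
  have h1 : ‖Dstar x‖ ^ 2 ≤ ‖x‖ * ‖D (Dstar x)‖ := by
    have e : (‖Dstar x‖ ^ 2 : ℝ) = RCLike.re ⟪x, D (Dstar x)⟫_𝕜 := by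
      rw [← hadj, inner_self_eq_norm_sq (𝕜 := 𝕜)]
    rw [e]
    exact (RCLike.re_le_norm _).trans (norm_inner_le_norm _ _)
  -- `‖D D*x‖ ≤ √C·‖D*x‖`
  have h0 : 0 ≤ Real.sqrt C * ‖Dstar x‖ := by positivity
  have h2 : ‖D (Dstar x)‖ ≤ Real.sqrt C * ‖Dstar x‖ := by
    have hsq : ‖D (Dstar x)‖ ^ 2 ≤ (Real.sqrt C * ‖Dstar x‖) ^ 2 := by
      rw [mul_pow, Real.sq_sqrt hC]; exact hB
    exact (sq_le_sq₀ (norm_nonneg _) h0).mp hsq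
  -- combine: `‖D*x‖² ≤ √C·‖x‖·‖D*x‖`, hence `‖D*x‖ ≤ √C·‖x‖`
  have h3 : ‖Dstar x‖ ^ 2 ≤ Real.sqrt C * ‖x‖ * ‖Dstar x‖ := by
    calc ‖Dstar x‖ ^ 2 ≤ ‖x‖ * ‖D (Dstar x)‖ := h1
      _ ≤ ‖x‖ * (Real.sqrt C * ‖Dstar x‖) := mul_le_mul_of_nonneg_left h2 (norm_nonneg _)
      _ = Real.sqrt C * ‖x‖ * ‖Dstar x‖ := by ring
  have h4 : ‖Dstar x‖ ≤ Real.sqrt C * ‖x‖ := by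
    by_cases hz : ‖Dstar x‖ = 0
    · rw [hz]; positivity
    · have hpos : 0 < ‖Dstar x‖ := lt_of_le_of_ne (norm_nonneg _) (Ne.symm hz)
      have := h3
      rw [pow_two] at this
      exact le_of_mul_le_mul_right this hpos
  calc ‖Dstar x‖ ^ 2 ≤ (Real.sqrt C * ‖x‖) ^ 2 := pow_le_pow_left₀ (norm_nonneg _) h4 2
    _ = C * ‖x‖ ^ 2 := by rw [mul_pow, Real.sq_sqrt hC]

/-- ★★ **BERNSTEIN ON A SUBSPACE CONTAINING `D*x` ⟹ THE DIVERGENCE BOUND**: if `‖Df‖² ≤ C‖f‖²` for every `f` with `M f` (a predicate, e.g. `f ∈ ker R`), and `M (D*x)`, then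
`‖D*x‖² ≤ C‖x‖²`. [folklore] [cite: Balaban1985BackgroundPropagators, (3.21) p.394] -/
theorem norm_sq_dstar_le_of_bernstein_on (D : S →ₗ[𝕜] E) (Dstar : E →ₗ[𝕜] S)
    (hadj : ∀ (x : E) (f : S), ⟪Dstar x, f⟫_𝕜 = ⟪x, D f⟫_𝕜) {C : ℝ} (hC : 0 ≤ C) (M : S → Prop)
    (hBern : ∀ f : S, M f → ‖D f‖ ^ 2 ≤ C * ‖f‖ ^ 2) (x : E) (hx : M (Dstar x)) :
    ‖Dstar x‖ ^ 2 ≤ C * ‖x‖ ^ 2 :=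
  norm_sq_dstar_le_of_bernstein_at D Dstar hadj hC x (hBern _ hx)

end CrudeAbstract

section CrudeMember

variable (F : T3Family) (n K : ℕ) (h : n ≤ K) (c₀ cB : ℝ) [Fact (0 < c₀)] [Fact (0 < cB)]

/-- `D*_{U₀}` and `D_{U₀}` at the member are an adjoint pair on the weighted `L²` spaces (✓`adjoint_DL2`). [cite: Balaban1985BackgroundPropagators, (3.8) p.392] -/
theorem inner_DstarL2_left (U₀ : GaugeField (F.P K) 0 (Matrix.specialUnitaryGroup (Fin 2) ℂ))
    (x : BondL2K ℂ 3 (periodsT3 F K) c₀ W₂) (f : SiteL2K ℂ 3 (periodsT3 F K) c₀ W₂) :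
    ⟪DstarL2 F n K c₀ U₀ x, f⟫_ℂ = ⟪x, DL2 F n K c₀ U₀ f⟫_ℂ := by
  rw [← Prop7SectET3HilbertLetters.adjoint_DL2, LinearMap.adjoint_inner_left]

omit [Fact (0 < cB)] in
/-- ★★★ **THE CRUDE SLICE ON PRINT'S SLICE (PLAN (A′) P-A4).**  If the member's gauge-parameter space satisfies a BERNSTEIN ROW ON `ker R_S(U₀)` — `‖D_{U₀}f‖² ≤ C·‖f‖²` for
every `f` with `R_S(U₀) f = 0` (flat: alias-sum Bernstein for `range Δ⁻¹(Q∘D)ᵀ`, `C = C_B·ℓ⁻²`; curved: N06∕perturbative) — then every route field `X` in the projected Landau gauge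
(21)ˢ has `‖D*_{U₀}X̃‖² ≤ C·‖X̃‖²`, `X̃ = toL2 X`: the divergence budget `DIV ≤ δ₁ℓ⁻²M` of the doors with `ζ = 0` and NO alignment row.
[cite: Balaban1985Variational, (21) p.281; Balaban1985BackgroundPropagators, (3.21)–(3.23) p.394, (3.126) p.420] -/
theorem div_sq_le_of_bernstein_ker_RS_of_isLandauPrintS (U₀ : GaugeField (F.P K) 0 (Matrix.specialUnitaryGroup (Fin 2) ℂ)) {C : ℝ} (hC : 0 ≤ C)
    (hBern : ∀ f : SiteL2K ℂ 3 (periodsT3 F K) c₀ W₂, RS F n K h c₀ cB U₀ f = 0 → ‖DL2 F n K c₀ U₀ f‖ ^ 2 ≤ C * ‖f‖ ^ 2)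
    (X : PBond (F.P K) 0 → Matrix (Fin 2) (Fin 2) ℂ) (hX : IsLandauPrintS F n K h c₀ cB U₀ X) :
    ‖DstarL2 F n K c₀ U₀ (toL2 F K c₀ X)‖ ^ 2 ≤ C * ‖toL2 F K c₀ X‖ ^ 2 :=
  norm_sq_dstar_le_of_bernstein_on (DL2 F n K c₀ U₀) (DstarL2 F n K c₀ U₀) (inner_DstarL2_left F n K c₀ U₀) hC
    (fun f => RS F n K h c₀ cB U₀ f = 0) hBern (toL2 F K c₀ X) ((isLandauPrintS_iff_RS (h := h) (cB := cB) U₀ X).1 hX)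

end CrudeMember

end Summit.QuantumFields.YangMills.Theorems.Prop7HessOnPrintSlice

end
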